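import Summits.QuantumFields.YangMills.Theorems.UnitScaleTiltProp7OneStepDefectT3
import HarnessLib

/-!
# Route `UnitScaleTilt`, crux «MinimiserStabilityRegPr» (stmt-QuantumFields-19200), route-R E′ (A′)-comb, COMB-FLAT COERCIVITY ⟸ (I3′), PLAN B (px22 g5 ac2baf06; lane w4-19200 g8): P2 v1.1 — **THE SUPPORT ∕ TOTAL-VARIATION ROW (hW) OF THE ONE-STEP DEFECT AND ITS ℝ-LINEARITY**, in the exact shape of P1
# ✓`Prop7GradBlindLocalCurlBound.normSq_le_of_gradBlind_local` (px6 g6 WORD 2026-08-29 06:36:27Z «the SUPPORT ROW, in w4's (hW) shape … PLUS ℝ-linearity»; box = w4 g9 06:41:25Z LOCATED POINTER VERBATIM: corner anchor `x₀ c := Site.blockSite c.src 0` (label `(c₋)_μ·L`), side `s := 2L + (L−1)∕2`, no-wrap range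
# `j + 2 ≤ m + K`): every bond read by `e Y c = linAvg Y c − γ Y c` has its source in that box, so `‖e Y c‖ ≤ Wt·M` whenever `‖Y b‖ ≤ M` on the box bonds, `Wt := (4d+6)L`; and `Y ↦ e Y c` is ℝ-linear

Cell `ym3-torus` (HUMAN RULING D-0037, YM ladder rung R3 — YM₃ on T³ is a rung, NOT d = 4, NOT infinite volume, NOT a mass gap, NOT Clay; YM gap NOT proved), width seat `ym3-torus-px21` (gen 6). THEOREMS ONLY (0 `def`, 0 `sorry`;
letters inline as in ✓`Prop7OneStepDefect`); `--supports stmt-QuantumFields-19200 --as helper`; count-neutral.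

THE PRINT. [Balaban1987RG1] (0.3)–(0.4) pp. 252–253 (the staircases `Γ ∈ G(y,x)` stay inside the cube of `B(y)`: "take |n_{π(1)}| bonds in the direction sign n_{π(1)} e_{π(1)} starting at y, …", `|n_μ| ≤ (L−1)∕2`; the straight
contour `[x, x′]`, `x′ = x + L e_μ`), [Balaban1985Averaging] (42) p. 24, (110)–(112) p. 34 (block frames along the tree contours `Γ_{y,x}` inside the block), (124)–(125) p. 36; [Balaban1984PropagatorsI] (1.7)–(1.8) pp. 18–19
(`Γ_{y,x}` changes one coordinate at a time, monotonically). Print's locality «the averages depend on the variables in the block and its neighbours only» — here as an explicit torus box with crude L-only weights.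

WHAT IS PROVED (ns `…Theorems.Prop7OneStepDefectSupport`; `P : Params` (so `L` odd, `L ≥ 3`), level `j`, `N := P.sitesPerDir j = 2L^{m+K−j}`, `h := (L−1)∕2`).
* §1 prefixes of contours (monotonicity): `netDisp_take_axisRun`, `netDisp_take_stairRuns_of_not_mem`, ★ `netDisp_take_stairRuns_mem` (every prefix of a staircase has `μ`-displacement BETWEEN `0`
  and `n_μ`), `netDisp_take_stairWord_mem`, `seg_eq_axisRun`, `stairRuns_eq_flatMap`, `treeWord_eq_stairRuns`, ★ `netDisp_take_treeWord_mem`, `netDisp_take_replicate_true_mem`;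
  `norm_walkSum_le_length_mul` (`‖walkSum Y γ‖ ≤ |γ|·M` if `‖Y‖ ≤ M` on the steps of `γ`).
* §2 the box `x₀ + [0, s)^d`, `x₀ = z₀ + o`: `val_transl_sub_transl_lt`, ★ `src_mem_box_of_mem_walk` (a walk from `z₀ + a` whose prefixes stay in `[lo, hi]` reads only bonds with source in the box when
  `o ≤ a + lo`, `a + hi < o + s`), `src_runBond_mem_box`; `boxSide_succ_le_sitesPerDir` (`2L + h + 1 ≤ N` when `j + 2 ≤ m + K` — P1's `hs`), `blockSite_zero_eq_transl` (`blockSite y 0 = emb y − h·1⃗`).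
* §3 ★★★ `norm_oneStepDefect_le_of_box` — **(hW)** with `x₀ := Site.blockSite c.src (fun _ ↦ ⟨0, P.L_pos⟩)`, `s := 2L + (L−1)∕2`, `Wt := (4d+6)L`, under `hj : j + 2 ≤ P.m + P.K`:
  `(∀ b, (∀ μ, (b.src μ − x₀ μ).val < s) → ‖Y b‖ ≤ M) → ‖linAvg Y c − γ Y c‖ ≤ ((4d+6)L : ℕ)·M`  (stairs `≤ (d+2)L` bonds twice, the straight piece `L`, the tube `L`, the two tree means `≤ dL` each).
* §4 `segSum_add'`, `segSum_smul'`, ★★ `oneStepDefect_add`, `oneStepDefect_smul`, ★★ `isLinearMap_oneStepDefect` — `Y ↦ linAvg Y c − γ Y c` is ℝ-linear; P1's bundled `e` is `IsLinearMap.mk' _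
  (isLinearMap_oneStepDefect c)`, (hblind) is ✓`Prop7OneStepDefect.oneStepDefect_grad`, `hs` is `boxSide_succ_le_sitesPerDir hj` — so ✓`normSq_le_of_gradBlind_local` applies by `exact`.
HONEST SCOPE.  Crude weights (`(4d+6)L`, not the sharp count); box side `2L + (L−1)∕2` as in PLAN B §3 ∕ w4's pointer; nothing of P1∕P3∕P4∕(I3′)∕COMB-FLAT∕the crux.

References: T. Bałaban, CMP **109** (1987) 249–301 [Balaban1987RG1] ((0.3)–(0.4) pp.252–253); CMP **98** (1985) 17–51 [Balaban1985Averaging] ((42) p.24, (110)–(112) p.34, (124)–(125) p.36);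
CMP **95** (1984) 17–40 [Balaban1984PropagatorsI] ((1.7)–(1.8) pp.18–19).
-/

set_option autoImplicit false

noncomputable section

open scoped Matrix.Norms.L2Operator BigOperators

namespace Summit.QuantumFields.YangMills.Theorems.Prop7OneStepDefectSupport

open Literature.MathematicalPhysics.QuantumFieldTheory.Balaban1983to89
open B7Prop1Explicit renaming Site → LSite
open B7Prop1Explicit (boxVec treeWord e l1 length_treeWord l1_boxVec_le)
open B10Eq27TorusAxialLog (transl transl_apply transl_add transl_zero)
open T4Continuum BlockAveraging LatticeFieldCalculus
open T4ReflectionCone (netDisp_append netDisp_replicate)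
open BlockAveragingEMLLinearised (walkSum walkSum_cons linAvg linAvg_def length_walk length_walk_stairWord_le)
open Summit.QuantumFields.YangMills.Theorems.Prop8Chart (walkSum_const_smul linAvg_const_smul)
open Summit.QuantumFields.YangMills.Theorems.Prop7CombGauge (walkSum_add)
open Summit.QuantumFields.YangMills.Theorems.Prop7LinAvgOnto (linAvg_add)
open Summit.QuantumFields.YangMills.Theorems.Prop7DefectChainForms (transl_add_natSmul_e_eq_runSite)
open Summit.QuantumFields.YangMills.Theorems.Prop7OneStepDefect (runSite_emb_eq_emb_shift runSite_transl_comm)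

variable {P : Params} {j : ℕ}

/-! ## §1 Prefixes of contours: a staircase ∕ tree contour changes each coordinate monotonically -/

/-- The `κ`-displacement of a prefix of the run `sign(z)·e_μ`, `|z|` times: `± min(k, |z|)` on the axis, `0` off it. [cite: Balaban1987RG1, (0.3) p.252] -/
theorem netDisp_take_axisRun {d : ℕ} (μ : Fin d) (z : ℤ) (k : ℕ) (κ : Fin d) :
    netDisp ((axisRun μ z).take k) κ = if μ = κ then (if 0 ≤ z then ((min k z.natAbs : ℕ) : ℤ) else -((min k z.natAbs : ℕ) : ℤ)) else 0 := by
  rw [axisRun, List.take_replicate, netDisp_replicate]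
  by_cases hμ : μ = κ
  · by_cases hz : 0 ≤ z <;> simp [hμ, hz]
  · simp [hμ]

/-- A staircase through axes not containing `κ` never moves the `κ`-coordinate. [cite: Balaban1987RG1, (0.3) p.252] -/
theorem netDisp_take_stairRuns_of_not_mem {d : ℕ} (n : Fin d → ℤ) (κ : Fin d) :
    ∀ (as : List (Fin d)), κ ∉ as → ∀ k : ℕ, netDisp ((stairRuns n as).take k) κ = 0
  | [], _, k => by simp [stairRuns, netDisp]
  | a :: as, h, k => by
    rw [List.mem_cons, not_or] at h
    rw [stairRuns, List.take_append, netDisp_append, netDisp_take_axisRun, if_neg (Ne.symm h.1),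
      netDisp_take_stairRuns_of_not_mem n κ as h.2, add_zero]

/-- ★ **STAIRCASES ARE MONOTONE**: every prefix of the staircase through a duplicate-free list of axes has `κ`-displacement between `0` and `n_κ`
("take |n_{π(1)}| bonds in the direction sign n_{π(1)} e_{π(1)} starting at y, |n_{π(2)}| bonds … starting at y + δ n_{π(1)} e_{π(1)}, and so on"). [cite: Balaban1987RG1, (0.3) p.252] -/
theorem netDisp_take_stairRuns_mem {d : ℕ} (n : Fin d → ℤ) (κ : Fin d) :
    ∀ (as : List (Fin d)), as.Nodup → ∀ k : ℕ,
      min 0 (n κ) ≤ netDisp ((stairRuns n as).take k) κ ∧ netDisp ((stairRuns n as).take k) κ ≤ max 0 (n κ)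
  | [], _, k => by
    simp only [stairRuns, List.take_nil, (show netDisp ([] : List (Letter d)) κ = 0 by simp [netDisp])]; exact ⟨min_le_left _ _, le_max_left _ _⟩
  | a :: as, h, k => by
    rw [List.nodup_cons] at h
    rw [stairRuns, List.take_append, netDisp_append, netDisp_take_axisRun]
    by_cases hak : a = κ
    · subst hak
      rw [if_pos rfl, netDisp_take_stairRuns_of_not_mem n a as h.1, add_zero]
      split_ifs <;> omega
    · rw [if_neg hak, zero_add]
      exact netDisp_take_stairRuns_mem n κ as h.2 _

/-- The staircase `Γ ∈ G(y, y+n)` of the ordering `σ`: every prefix has `κ`-displacement between `0` and `n_κ`. [cite: Balaban1987RG1, (0.3) p.252] -/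
theorem netDisp_take_stairWord_mem {d : ℕ} (σ : Equiv.Perm (Fin d)) (n : Fin d → ℤ) (k : ℕ) (κ : Fin d) :
    min 0 (n κ) ≤ netDisp ((stairWord σ n).take k) κ ∧ netDisp ((stairWord σ n).take k) κ ≤ max 0 (n κ) :=
  netDisp_take_stairRuns_mem n κ _ (nodup_finRange_map σ) k

/-- B7's straight segment word is the axis run of `BlockAveraging`. [folklore] -/
theorem seg_eq_axisRun {d : ℕ} (κ : Fin d) (z : ℤ) : B7Prop1Explicit.seg κ z = axisRun κ z := by
  rcases Int.eq_nat_or_neg z with ⟨m, rfl | rfl⟩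
  · simp [axisRun]
  · cases m with
    | zero => simp [axisRun]
    | succ m =>
      rw [B7Prop1Explicit.seg_neg_natCast, axisRun, Int.natAbs_neg, Int.natAbs_natCast,
        decide_eq_false (show ¬ (0 ≤ -((m + 1 : ℕ) : ℤ)) by omega)]

/-- The staircase through a list of axes is the concatenation of its runs. [folklore] -/
theorem stairRuns_eq_flatMap {d : ℕ} (n : Fin d → ℤ) : ∀ as : List (Fin d), stairRuns n as = as.flatMap (fun a => axisRun a (n a))
  | [] => by simp [stairRuns]
  | a :: as => by rw [stairRuns, List.flatMap_cons, stairRuns_eq_flatMap n as]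

/-- The tree contour `Γ_{y,y+v}` (coordinates changed in the order `d, …, 1`) is the staircase through the reversed list of axes. [cite: Balaban1984PropagatorsI, (1.7) p.18] -/
theorem treeWord_eq_stairRuns {d : ℕ} (v : LSite d) : treeWord v = stairRuns v (List.finRange d).reverse := by
  rw [stairRuns_eq_flatMap]; unfold treeWord; simp only [seg_eq_axisRun]

/-- ★ **TREE CONTOURS ARE MONOTONE**: every prefix of `Γ_{y,y+v}` has `κ`-displacement between `0` and `v_κ`. [cite: Balaban1984PropagatorsI, (1.7) p.18] -/
theorem netDisp_take_treeWord_mem {d : ℕ} (v : LSite d) (k : ℕ) (κ : Fin d) :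
    min 0 (v κ) ≤ netDisp ((treeWord v).take k) κ ∧ netDisp ((treeWord v).take k) κ ≤ max 0 (v κ) := by
  rw [treeWord_eq_stairRuns]
  exact netDisp_take_stairRuns_mem v κ _ (List.nodup_reverse.mpr (List.nodup_finRange d)) k

/-- Prefixes of the straight contour `[x, x + m e_μ]`: displacement in `[0, m]`. [cite: Balaban1987RG1, (0.4) p.253] -/
theorem netDisp_take_replicate_true_mem {d : ℕ} (μ : Fin d) (m k : ℕ) (κ : Fin d) :
    0 ≤ netDisp ((List.replicate m (μ, true)).take k) κ ∧ netDisp ((List.replicate m (μ, true)).take k) κ ≤ m := by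
  rw [List.take_replicate, netDisp_replicate]
  by_cases h : μ = κ
  · simp only [h, if_true]; omega
  · simp [h]

/-- **THE SUP ROW OF A WALK SUM**: if `‖Y‖ ≤ M` on the steps of `γ` then `‖walkSum Y γ‖ ≤ |γ|·M`. [cite: Balaban1984PropagatorsI, (1.8) p.19] -/
theorem norm_walkSum_le_length_mul {V : Type*} [SeminormedAddCommGroup V] (Y : PBond P j → V) {M : ℝ} :
    ∀ γ : List (LStep P j), (∀ s ∈ γ, ‖Y s.bond‖ ≤ M) → ‖walkSum Y γ‖ ≤ (γ.length : ℝ) * M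
  | [], _ => by simp [walkSum]
  | s :: γ, h => by
    rw [walkSum_cons, List.length_cons]
    have hs : ‖(if s.fwd then Y s.bond else -Y s.bond)‖ ≤ M := by
      split_ifs
      · exact h s (List.mem_cons_self)
      · rw [norm_neg]; exact h s (List.mem_cons_self)
    have ih := norm_walkSum_le_length_mul Y γ fun s' hs' => h s' (List.mem_cons_of_mem _ hs')
    calc ‖(if s.fwd then Y s.bond else -Y s.bond) + walkSum Y γ‖ ≤ M + (γ.length : ℝ) * M := (norm_add_le _ _).trans (add_le_add hs ih)
      _ = ((γ.length + 1 : ℕ) : ℝ) * M := by push_cast; ring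

/-! ## §2 The box `x₀ + [0, s)^d` with `x₀ = z₀ + o` -/

/-- An integer offset `u` from `z₀` with `o ≤ u < o + s` coordinatewise lies in the torus box of side `s ≤ N` anchored at `z₀ + o` (no wrap). [folklore] -/
theorem val_transl_sub_transl_lt (z₀ : Site P j) (u o : LSite P.d) {s : ℕ} (hsN : s ≤ P.sitesPerDir j) (μ : Fin P.d)
    (h0 : o μ ≤ u μ) (hs : u μ < o μ + s) : ((transl z₀ u) μ - (transl z₀ o) μ).val < s := by
  have hcast : (transl z₀ u) μ - (transl z₀ o) μ = (((u μ - o μ : ℤ)) : ZMod (P.sitesPerDir j)) := by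
    rw [transl_apply, transl_apply]; push_cast; ring
  have hval : (((transl z₀ u) μ - (transl z₀ o) μ).val : ℤ) = u μ - o μ := by
    rw [hcast, ZMod.val_intCast, Int.emod_eq_of_lt (by omega) (by omega)]
  have : (((transl z₀ u) μ - (transl z₀ o) μ).val : ℤ) < s := by rw [hval]; omega
  exact_mod_cast this

/-- ★ **A WALK WHOSE PREFIXES STAY IN `[lo, hi]` READS ONLY THE BOX**: every bond of `walk (z₀ + a) w` has its source (the end of a prefix: ✓`exists_src_eq_walkEnd_take`, ✓`walkEnd_apply`)
in the box `z₀ + o + [0, s)^d` once `o ≤ a + lo` and `a + hi < o + s`. [cite: Balaban1987RG1, (0.3)–(0.4) pp.252–253] -/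
theorem src_mem_box_of_mem_walk (z₀ : Site P j) (a o : LSite P.d) (w : List (Letter P.d)) (lo hi : Fin P.d → ℤ)
    (hw : ∀ (k : ℕ) (κ : Fin P.d), lo κ ≤ netDisp (w.take k) κ ∧ netDisp (w.take k) κ ≤ hi κ) {s : ℕ} (hsN : s ≤ P.sitesPerDir j)
    (hlo : ∀ κ, o κ ≤ a κ + lo κ) (hhi : ∀ κ, a κ + hi κ < o κ + s) (st : LStep P j) (hst : st ∈ walk (transl z₀ a) w) (μ : Fin P.d) :
    (st.bond.src μ - (transl z₀ o) μ).val < s := by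
  obtain ⟨k, hk⟩ := exists_src_eq_walkEnd_take _ _ st hst
  have hsrc : st.bond.src = transl z₀ (fun ν => a ν + netDisp (w.take k) ν) := by
    rw [hk]; funext ν; rw [walkEnd_apply, transl_apply, transl_apply]; push_cast; ring
  rw [hsrc]
  have h1 := hw k μ; have h2 := hlo μ; have h3 := hhi μ
  exact val_transl_sub_transl_lt z₀ _ o hsN μ (by show o μ ≤ a μ + netDisp (w.take k) μ; omega)
    (by show a μ + netDisp (w.take k) μ < o μ + s; omega)

/-- The bonds of the straight contour of `t < T` steps `+e_κ` from `z₀ + a` lie in the box once `o ≤ a` and `a + T ≤ o + s`. [cite: Balaban1984PropagatorsI, (1.7) p.18] -/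
theorem src_runBond_mem_box (z₀ : Site P j) (a o : LSite P.d) (κ : Fin P.d) {T s : ℕ} (hsN : s ≤ P.sitesPerDir j)
    (hlo : ∀ μ, o μ ≤ a μ) (hhi : ∀ μ, a μ + (T : ℤ) ≤ o μ + s) {t : ℕ} (ht : t < T) (μ : Fin P.d) :
    ((runBond (transl z₀ a) κ t).src μ - (transl z₀ o) μ).val < s := by
  have hsrc : (runBond (transl z₀ a) κ t).src = transl z₀ (a + ((t : ℕ) : ℤ) • e κ) := by
    rw [runBond, transl_add_natSmul_e_eq_runSite]
  rw [hsrc]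
  have h2 := hlo μ; have h3 := hhi μ; have ht' : ((t : ℕ) : ℤ) < T := by exact_mod_cast ht
  refine val_transl_sub_transl_lt z₀ _ o hsN μ ?_ ?_ <;>
    rw [Pi.add_apply, Pi.smul_apply, B7Prop1Explicit.e_apply] <;> split_ifs <;>
      simp only [smul_eq_mul, mul_one, mul_zero, add_zero] <;> omega

/-- **NO WRAP ONE LEVEL BELOW THE TOP**: `2L + (L−1)∕2 + 1 ≤ N = 2L^{m+K−j}` whenever `j + 2 ≤ m + K` (P1's side condition `hs` for the box of §3). [folklore] -/
theorem boxSide_succ_le_sitesPerDir (hj : j + 2 ≤ P.m + P.K) : 2 * P.L + (P.L - 1) / 2 + 1 ≤ P.sitesPerDir j := by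
  unfold Params.sitesPerDir
  have hL : 1 < P.L := P.hL.2; have hh : (P.L - 1) / 2 < P.L := by omega
  have h2 : P.L ^ 2 ≤ P.L ^ (P.m + P.K - j) := Nat.pow_le_pow_right P.L_pos (by omega)
  nlinarith [h2, hL, hh]

/-- The block corner is the centre minus `(L−1)∕2` in every coordinate: `blockSite y 0 = emb y − ((L−1)∕2)·1⃗` (labels `nL` vs `nL + (L−1)∕2`). [cite: Balaban1987RG1, (0.1) p.252] -/
theorem blockSite_zero_eq_transl (y : Site P (j + 1)) :
    Site.blockSite y (fun _ => ⟨0, P.L_pos⟩) = transl (emb y) (fun _ => -(((P.L - 1) / 2 : ℕ) : ℤ)) := by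
  funext μ
  rw [transl_apply]
  simp only [Site.blockSite, emb, Int.cast_neg, Int.cast_natCast]
  push_cast
  ring

/-! ## §3 ★★★ (hW): the one-step defect reads only the box `blockSite c₋ 0 + [0, 2L + (L−1)∕2)^d` and has total variation `≤ (4d+6)L` -/

section HW

variable {n : Type*} [Fintype n] [DecidableEq n]

/-- ★★★ **(hW) FOR THE ONE-STEP DEFECT** — P1's hypothesis shape VERBATIM with `x₀ := Site.blockSite c.src (fun _ ↦ ⟨0, P.L_pos⟩)` (label `(c₋)_μ·L`), `s := 2L + (L−1)∕2`, `Wt := (4d+6)L`,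
one level of room (`j + 2 ≤ m + K`, w4 g9's no-wrap range): if `‖Y b‖ ≤ M` for every bond whose source lies in the box, then `‖linAvg Y c − γ Y c‖ ≤ Wt·M`.  (Offsets from the corner:
stairs in `B(c₋)` `∈ [0, L−1]`, the straight piece and the stairs in `B(c₊)` `∈ [0, 2L−1]`, the tube `∈ [h, h+2L−2]`, the tree contours `∈ [h, h+2L−1]`, `h = (L−1)∕2` — all `< s`; weights:
stairs `≤ (d+2)L` twice, straight `L`, tube `L`, trees `≤ dL` twice.) [cite: Balaban1987RG1, (0.3)–(0.4) pp.252–253; Balaban1985Averaging, (124)–(125) p.36, (112) p.34] -/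
theorem norm_oneStepDefect_le_of_box (hj : j + 2 ≤ P.m + P.K) (Y : PBond P j → Matrix n n ℂ) (c : PBond P (j + 1)) {M : ℝ}
    (hM : ∀ b : PBond P j, (∀ μ, (b.src μ - (Site.blockSite c.src (fun _ => ⟨0, P.L_pos⟩)) μ).val < 2 * P.L + (P.L - 1) / 2) → ‖Y b‖ ≤ M) :
    ‖linAvg Y c
        - ( ((((P.L : ℝ)) ^ P.d)⁻¹) • ∑ r : Fin P.d → Fin P.L, segSum Y (transl (emb c.src) (boxVec P.L r)) c.dir P.L
            - ( ((((P.L : ℝ)) ^ P.d)⁻¹) • ∑ r : Fin P.d → Fin P.L, walkSum Y (walk (emb c.tgt) (treeWord (boxVec P.L r)))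
              - ((((P.L : ℝ)) ^ P.d)⁻¹) • ∑ r : Fin P.d → Fin P.L, walkSum Y (walk (emb c.src) (treeWord (boxVec P.L r))) ) )‖
      ≤ (((4 * P.d + 6) * P.L : ℕ) : ℝ) * M := by
  have hL1 : 1 < P.L := P.hL.2; have hhL : 2 * ((P.L - 1) / 2) + 1 = P.L := AveragingRT.two_mul_half_add_one P
  have hsN : 2 * P.L + (P.L - 1) / 2 ≤ P.sitesPerDir j := Nat.le_of_succ_le (boxSide_succ_le_sitesPerDir hj)
  -- the anchor as a translate of the block centre: `x₀ = emb c₋ + o`, `o = −h·1⃗`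
  obtain ⟨o, ho⟩ : ∃ o : LSite P.d, ∀ κ, o κ = -(((P.L - 1) / 2 : ℕ) : ℤ) := ⟨fun _ => _, fun _ => rfl⟩
  have hx₀ : Site.blockSite c.src (fun _ => ⟨0, P.L_pos⟩) = transl (emb c.src) o := by
    rw [blockSite_zero_eq_transl, show o = fun _ => -(((P.L - 1) / 2 : ℕ) : ℤ) from funext ho]
  have hM' : ∀ b : PBond P j, (∀ μ, (b.src μ - (transl (emb c.src) o) μ).val < 2 * P.L + (P.L - 1) / 2) → ‖Y b‖ ≤ M :=
    fun b hb => hM b (fun μ => by rw [hx₀]; exact hb μ)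
  -- the base points as translates of `emb c.src`
  have htgt : emb c.tgt = transl (emb c.src) (0 + ((P.L : ℕ) : ℤ) • e c.dir) := by
    rw [transl_add_natSmul_e_eq_runSite, transl_zero, runSite_emb_eq_emb_shift]; rfl
  have ha3 : ∀ κ : Fin P.d, 0 ≤ (0 + ((P.L : ℕ) : ℤ) • e c.dir) κ ∧ (0 + ((P.L : ℕ) : ℤ) • e c.dir) κ ≤ P.L := fun κ => by
    rw [zero_add, Pi.smul_apply, B7Prop1Explicit.e_apply]; split_ifs <;> simp
  -- prefix ranges of the three kinds of words
  have hst : ∀ (σ : Equiv.Perm (Fin P.d)) (r : Fin P.d → Fin P.L) (k : ℕ) (κ : Fin P.d),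
      -(((P.L - 1) / 2 : ℕ) : ℤ) ≤ netDisp ((stairWord σ (off r)).take k) κ ∧ netDisp ((stairWord σ (off r)).take k) κ ≤ (((P.L - 1) / 2 : ℕ) : ℤ) :=
    fun σ r k κ => by
      have h := netDisp_take_stairWord_mem σ (off r) k κ
      have hb := off_bounds r κ
      constructor <;> omega
  have htr : ∀ (r : Fin P.d → Fin P.L) (k : ℕ) (κ : Fin P.d),
      0 ≤ netDisp ((treeWord (boxVec P.L r)).take k) κ ∧ netDisp ((treeWord (boxVec P.L r)).take k) κ ≤ (P.L : ℤ) - 1 := fun r k κ => by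
    have h := netDisp_take_treeWord_mem (boxVec P.L r) k κ
    have hr := (r κ).isLt
    simp only [boxVec] at h
    constructor <;> omega
  have hM0 : 0 ≤ M := by
    refine (norm_nonneg _).trans (hM' (runBond (transl (emb c.src) (boxVec P.L fun _ => ⟨0, P.L_pos⟩)) c.dir 0) fun μ => ?_)
    exact src_runBond_mem_box (emb c.src) _ o c.dir (T := P.L) hsN (fun ν => by have := ho ν; simp only [boxVec]; push_cast; omega)
      (fun ν => by have := ho ν; simp only [boxVec]; push_cast; omega) P.L_pos μ
  -- per-walk sup rows
  have hwalk : ∀ (a : LSite P.d) (w : List (Letter P.d)) (lo hi : Fin P.d → ℤ),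
      (∀ (k : ℕ) (κ : Fin P.d), lo κ ≤ netDisp (w.take k) κ ∧ netDisp (w.take k) κ ≤ hi κ) →
      (∀ κ, o κ ≤ a κ + lo κ) → (∀ κ, a κ + hi κ < o κ + ((2 * P.L + (P.L - 1) / 2 : ℕ) : ℤ)) →
      ‖walkSum Y (walk (transl (emb c.src) a) w)‖ ≤ (w.length : ℝ) * M := fun a w lo hi hw hlo hhi => by
    have h := norm_walkSum_le_length_mul Y (walk (transl (emb c.src) a) w)
      (fun st hst' => hM' st.bond (fun μ => src_mem_box_of_mem_walk (emb c.src) a o w lo hi hw hsN hlo hhi st hst' μ))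
    rwa [length_walk] at h
  have hstair_len : ∀ (σ : Equiv.Perm (Fin P.d)) (r : Fin P.d → Fin P.L), ((stairWord σ (off r)).length : ℝ) ≤ (((P.d + 2) * P.L : ℕ) : ℝ) := fun σ r => by
    have h := length_walk_stairWord_le (emb c.src) σ r; rw [length_walk] at h; exact_mod_cast h
  -- (i) the linearised average: three walks per index
  have hσ : ‖linAvg Y c‖ ≤ (((2 * P.d + 5) * P.L : ℕ) : ℝ) * M := by
    rw [linAvg_def, norm_smul, norm_inv, Complex.norm_natCast]
    have hcard : (0 : ℝ) < Fintype.card (Idx P) := Nat.cast_pos.mpr Fintype.card_pos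
    rw [inv_mul_le_iff₀ hcard]
    refine (norm_sum_le _ _).trans ?_
    have hterm : ∀ i : Idx P, ‖walkSum Y (walk (emb c.src) (stairWord i.2.1 (off i.1))) +
          walkSum Y (walk (walkEnd (emb c.src) (stairWord i.2.1 (off i.1))) (List.replicate P.L (c.dir, true))) -
          walkSum Y (walk (emb c.tgt) (stairWord i.2.2 (off i.1)))‖ ≤ (((2 * P.d + 5) * P.L : ℕ) : ℝ) * M := by
      intro i
      have hb := fun κ => off_bounds i.1 κ
      have h1 : ‖walkSum Y (walk (emb c.src) (stairWord i.2.1 (off i.1)))‖ ≤ (((P.d + 2) * P.L : ℕ) : ℝ) * M := by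
        have h := hwalk 0 (stairWord i.2.1 (off i.1)) (fun _ => -(((P.L - 1) / 2 : ℕ) : ℤ)) (fun _ => (((P.L - 1) / 2 : ℕ) : ℤ)) (hst i.2.1 i.1)
          (fun κ => by have := ho κ; simp only [Pi.zero_apply]; omega) (fun κ => by have := ho κ; simp only [Pi.zero_apply]; push_cast; omega)
        rw [transl_zero] at h
        exact h.trans (mul_le_mul_of_nonneg_right (hstair_len i.2.1 i.1) hM0)
      have hend : walkEnd (emb c.src) (stairWord i.2.1 (off i.1)) = transl (emb c.src) (off i.1) := by
        funext ν; rw [walkEnd_apply, transl_apply, netDisp_stairWord]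
      have h2 : ‖walkSum Y (walk (walkEnd (emb c.src) (stairWord i.2.1 (off i.1))) (List.replicate P.L (c.dir, true)))‖ ≤ ((P.L : ℕ) : ℝ) * M := by
        rw [hend]
        have h := hwalk (off i.1) (List.replicate P.L (c.dir, true)) (fun _ => 0) (fun _ => (P.L : ℤ))
          (fun k κ => netDisp_take_replicate_true_mem c.dir P.L k κ)
          (fun κ => by have := ho κ; have := hb κ; omega) (fun κ => by have := ho κ; have := hb κ; push_cast; omega)
        rwa [List.length_replicate] at h
      have h3 : ‖walkSum Y (walk (emb c.tgt) (stairWord i.2.2 (off i.1)))‖ ≤ (((P.d + 2) * P.L : ℕ) : ℝ) * M := by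
        rw [htgt]
        have h := hwalk (0 + ((P.L : ℕ) : ℤ) • e c.dir) (stairWord i.2.2 (off i.1)) (fun _ => -(((P.L - 1) / 2 : ℕ) : ℤ)) (fun _ => (((P.L - 1) / 2 : ℕ) : ℤ)) (hst i.2.2 i.1)
          (fun κ => by have := ho κ; have := ha3 κ; omega) (fun κ => by have := ho κ; have := ha3 κ; push_cast; omega)
        exact h.trans (mul_le_mul_of_nonneg_right (hstair_len i.2.2 i.1) hM0)
      calc _ ≤ ‖walkSum Y (walk (emb c.src) (stairWord i.2.1 (off i.1)))‖ +
            ‖walkSum Y (walk (walkEnd (emb c.src) (stairWord i.2.1 (off i.1))) (List.replicate P.L (c.dir, true)))‖ +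
            ‖walkSum Y (walk (emb c.tgt) (stairWord i.2.2 (off i.1)))‖ := norm_sub_le_of_le (norm_add_le _ _) le_rfl
        _ ≤ (((P.d + 2) * P.L : ℕ) : ℝ) * M + ((P.L : ℕ) : ℝ) * M + (((P.d + 2) * P.L : ℕ) : ℝ) * M := add_le_add (add_le_add h1 h2) h3
        _ = (((2 * P.d + 5) * P.L : ℕ) : ℝ) * M := by push_cast; ring
    calc ∑ i : Idx P, ‖walkSum Y (walk (emb c.src) (stairWord i.2.1 (off i.1))) +
          walkSum Y (walk (walkEnd (emb c.src) (stairWord i.2.1 (off i.1))) (List.replicate P.L (c.dir, true))) -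
          walkSum Y (walk (emb c.tgt) (stairWord i.2.2 (off i.1)))‖
        ≤ ∑ _i : Idx P, (((2 * P.d + 5) * P.L : ℕ) : ℝ) * M := Finset.sum_le_sum fun i _ => hterm i
      _ = (Fintype.card (Idx P) : ℝ) * ((((2 * P.d + 5) * P.L : ℕ) : ℝ) * M) := by rw [Finset.sum_const, Finset.card_univ, nsmul_eq_mul]
  -- means over `r`: `‖(Lᵈ)⁻¹ • Σ_r v_r‖ ≤ B` when `‖v_r‖ ≤ B`
  have hmean : ∀ (v : (Fin P.d → Fin P.L) → Matrix n n ℂ) (B : ℝ), (∀ r, ‖v r‖ ≤ B) → ‖((((P.L : ℝ)) ^ P.d)⁻¹) • ∑ r, v r‖ ≤ B := fun v B hv => by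
    have hLd : (0 : ℝ) < (P.L : ℝ) ^ P.d := by positivity
    rw [norm_smul, norm_inv, Real.norm_of_nonneg hLd.le, inv_mul_le_iff₀ hLd]
    refine (norm_sum_le _ _).trans ?_
    calc ∑ r : Fin P.d → Fin P.L, ‖v r‖ ≤ ∑ _r : Fin P.d → Fin P.L, B := Finset.sum_le_sum fun r _ => hv r
      _ = (P.L : ℝ) ^ P.d * B := by rw [Finset.sum_const, Finset.card_univ, Fintype.card_fun, Fintype.card_fin, Fintype.card_fin, nsmul_eq_mul]; push_cast; ring
  -- (ii) the cornered tube
  have hT : ‖((((P.L : ℝ)) ^ P.d)⁻¹) • ∑ r : Fin P.d → Fin P.L, segSum Y (transl (emb c.src) (boxVec P.L r)) c.dir P.L‖ ≤ ((P.L : ℕ) : ℝ) * M := by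
    refine hmean _ _ fun r => ?_
    unfold segSum
    refine (norm_sum_le _ _).trans ?_
    have hb : ∀ t ∈ Finset.range P.L, ‖Y (runBond (transl (emb c.src) (boxVec P.L r)) c.dir t)‖ ≤ M := fun t ht =>
      hM' _ (fun μ => src_runBond_mem_box (emb c.src) _ o c.dir (T := P.L) hsN
        (fun ν => by have := ho ν; simp only [boxVec]; omega)
        (fun ν => by have := ho ν; have := (r ν).isLt; simp only [boxVec]; push_cast; omega)
        (Finset.mem_range.1 ht) μ)
    calc ∑ t ∈ Finset.range P.L, ‖Y (runBond (transl (emb c.src) (boxVec P.L r)) c.dir t)‖ ≤ ∑ _t ∈ Finset.range P.L, M := Finset.sum_le_sum hb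
      _ = ((P.L : ℕ) : ℝ) * M := by rw [Finset.sum_const, Finset.card_range, nsmul_eq_mul]
  -- (iii) the tree contours from `emb c.src` and `emb c.tgt`
  have hΦ : ∀ (a : LSite P.d), (∀ κ, 0 ≤ a κ ∧ a κ ≤ (P.L : ℤ)) → ∀ y : Site P (j + 1), emb y = transl (emb c.src) a →
      ‖((((P.L : ℝ)) ^ P.d)⁻¹) • ∑ r : Fin P.d → Fin P.L, walkSum Y (walk (emb y) (treeWord (boxVec P.L r)))‖ ≤ (((P.d * P.L : ℕ)) : ℝ) * M :=
    fun a ha y hy => by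
      refine hmean _ _ fun r => ?_
      rw [hy]
      have h := hwalk a (treeWord (boxVec P.L r)) (fun _ => 0) (fun _ => (P.L : ℤ) - 1) (htr r)
        (fun κ => by have := ho κ; have := ha κ; omega) (fun κ => by have := ho κ; have := ha κ; push_cast; omega)
      refine h.trans (mul_le_mul_of_nonneg_right ?_ hM0)
      rw [length_treeWord]; exact_mod_cast l1_boxVec_le P.L r
  have hΦsrc := hΦ 0 (fun κ => by simp) c.src (transl_zero _).symm; have hΦtgt := hΦ _ ha3 c.tgt htgt
  -- assemble
  calc _ ≤ ‖linAvg Y c‖ + (‖((((P.L : ℝ)) ^ P.d)⁻¹) • ∑ r : Fin P.d → Fin P.L, segSum Y (transl (emb c.src) (boxVec P.L r)) c.dir P.L‖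
            + (‖((((P.L : ℝ)) ^ P.d)⁻¹) • ∑ r : Fin P.d → Fin P.L, walkSum Y (walk (emb c.tgt) (treeWord (boxVec P.L r)))‖
              + ‖((((P.L : ℝ)) ^ P.d)⁻¹) • ∑ r : Fin P.d → Fin P.L, walkSum Y (walk (emb c.src) (treeWord (boxVec P.L r)))‖)) :=
          norm_sub_le_of_le le_rfl (norm_sub_le_of_le le_rfl (norm_sub_le _ _))
    _ ≤ (((2 * P.d + 5) * P.L : ℕ) : ℝ) * M + (((P.L : ℕ) : ℝ) * M + ((((P.d * P.L : ℕ)) : ℝ) * M + (((P.d * P.L : ℕ)) : ℝ) * M)) :=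
          add_le_add hσ (add_le_add hT (add_le_add hΦtgt hΦsrc))
    _ = (((4 * P.d + 6) * P.L : ℕ) : ℝ) * M := by push_cast; ring

end HW

/-! ## §4 ℝ-linearity of the one-step defect (for P1's bundled `e`) -/

/-- The straight-segment sum is additive in the field. [folklore] -/
theorem segSum_add' {n : Type*} (Y Y' : PBond P j → Matrix n n ℂ) (x : Site P j) (μ : Fin P.d) (N : ℕ) :
    segSum (fun b => Y b + Y' b) x μ N = segSum Y x μ N + segSum Y' x μ N := by
  unfold segSum; rw [← Finset.sum_add_distrib]

/-- The straight-segment sum commutes with real scalars. [folklore] -/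
theorem segSum_smul' {n : Type*} (a : ℝ) (Y : PBond P j → Matrix n n ℂ) (x : Site P j) (μ : Fin P.d) (N : ℕ) :
    segSum (fun b => a • Y b) x μ N = a • segSum Y x μ N := by
  unfold segSum; rw [Finset.smul_sum]

section Linear

variable {n : Type*}

/-- ★★ **THE ONE-STEP DEFECT IS ADDITIVE**. [cite: Balaban1985Averaging, (124)–(125) p.36] -/
theorem oneStepDefect_add (Y Y' : PBond P j → Matrix n n ℂ) (c : PBond P (j + 1)) :
    (linAvg (fun b => Y b + Y' b) c
        - ( ((((P.L : ℝ)) ^ P.d)⁻¹) • ∑ r : Fin P.d → Fin P.L, segSum (fun b => Y b + Y' b) (transl (emb c.src) (boxVec P.L r)) c.dir P.L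
            - ( ((((P.L : ℝ)) ^ P.d)⁻¹) • ∑ r : Fin P.d → Fin P.L, walkSum (fun b => Y b + Y' b) (walk (emb c.tgt) (treeWord (boxVec P.L r)))
              - ((((P.L : ℝ)) ^ P.d)⁻¹) • ∑ r : Fin P.d → Fin P.L, walkSum (fun b => Y b + Y' b) (walk (emb c.src) (treeWord (boxVec P.L r))) ) ))
      = (linAvg Y c
          - ( ((((P.L : ℝ)) ^ P.d)⁻¹) • ∑ r : Fin P.d → Fin P.L, segSum Y (transl (emb c.src) (boxVec P.L r)) c.dir P.L
              - ( ((((P.L : ℝ)) ^ P.d)⁻¹) • ∑ r : Fin P.d → Fin P.L, walkSum Y (walk (emb c.tgt) (treeWord (boxVec P.L r)))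
                - ((((P.L : ℝ)) ^ P.d)⁻¹) • ∑ r : Fin P.d → Fin P.L, walkSum Y (walk (emb c.src) (treeWord (boxVec P.L r))) ) ))
        + (linAvg Y' c
          - ( ((((P.L : ℝ)) ^ P.d)⁻¹) • ∑ r : Fin P.d → Fin P.L, segSum Y' (transl (emb c.src) (boxVec P.L r)) c.dir P.L
              - ( ((((P.L : ℝ)) ^ P.d)⁻¹) • ∑ r : Fin P.d → Fin P.L, walkSum Y' (walk (emb c.tgt) (treeWord (boxVec P.L r)))
                - ((((P.L : ℝ)) ^ P.d)⁻¹) • ∑ r : Fin P.d → Fin P.L, walkSum Y' (walk (emb c.src) (treeWord (boxVec P.L r))) ) )) := by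
  simp only [linAvg_add, segSum_add', walkSum_add, Finset.sum_add_distrib, smul_add]
  abel

/-- ★★ **THE ONE-STEP DEFECT COMMUTES WITH REAL SCALARS**. [cite: Balaban1985Averaging, (124)–(125) p.36] -/
theorem oneStepDefect_smul (a : ℝ) (Y : PBond P j → Matrix n n ℂ) (c : PBond P (j + 1)) :
    (linAvg (fun b => a • Y b) c
        - ( ((((P.L : ℝ)) ^ P.d)⁻¹) • ∑ r : Fin P.d → Fin P.L, segSum (fun b => a • Y b) (transl (emb c.src) (boxVec P.L r)) c.dir P.L
            - ( ((((P.L : ℝ)) ^ P.d)⁻¹) • ∑ r : Fin P.d → Fin P.L, walkSum (fun b => a • Y b) (walk (emb c.tgt) (treeWord (boxVec P.L r)))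
              - ((((P.L : ℝ)) ^ P.d)⁻¹) • ∑ r : Fin P.d → Fin P.L, walkSum (fun b => a • Y b) (walk (emb c.src) (treeWord (boxVec P.L r))) ) ))
      = a • (linAvg Y c
          - ( ((((P.L : ℝ)) ^ P.d)⁻¹) • ∑ r : Fin P.d → Fin P.L, segSum Y (transl (emb c.src) (boxVec P.L r)) c.dir P.L
              - ( ((((P.L : ℝ)) ^ P.d)⁻¹) • ∑ r : Fin P.d → Fin P.L, walkSum Y (walk (emb c.tgt) (treeWord (boxVec P.L r)))
                - ((((P.L : ℝ)) ^ P.d)⁻¹) • ∑ r : Fin P.d → Fin P.L, walkSum Y (walk (emb c.src) (treeWord (boxVec P.L r))) ) )) := by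
  have hlin : linAvg (fun b => a • Y b) c = a • linAvg Y c := by
    have h := linAvg_const_smul (a : ℂ) Y c
    have hfun : (fun b : PBond P j => (a : ℂ) • Y b) = fun b => a • Y b := funext fun b => Complex.coe_smul a (Y b)
    rw [hfun] at h; rw [h, Complex.coe_smul]
  simp only [hlin, segSum_smul', walkSum_const_smul, ← Finset.smul_sum, smul_sub, smul_comm a ((((P.L : ℝ)) ^ P.d)⁻¹)]

/-- ★★ **THE ONE-STEP DEFECT IS ℝ-LINEAR** — `IsLinearMap ℝ (Y ↦ linAvg Y c − γ Y c)`; P1's bundled `e` is `IsLinearMap.mk' _ (isLinearMap_oneStepDefect c)`, and with §3 (hW) and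
✓`Prop7OneStepDefect.oneStepDefect_grad` (hblind) ✓`normSq_le_of_gradBlind_local` applies by `exact`. [cite: Balaban1985Averaging, (124)–(125) p.36] -/
theorem isLinearMap_oneStepDefect (c : PBond P (j + 1)) :
    IsLinearMap ℝ (fun Y : PBond P j → Matrix n n ℂ =>
      linAvg Y c
        - ( ((((P.L : ℝ)) ^ P.d)⁻¹) • ∑ r : Fin P.d → Fin P.L, segSum Y (transl (emb c.src) (boxVec P.L r)) c.dir P.L
            - ( ((((P.L : ℝ)) ^ P.d)⁻¹) • ∑ r : Fin P.d → Fin P.L, walkSum Y (walk (emb c.tgt) (treeWord (boxVec P.L r)))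
              - ((((P.L : ℝ)) ^ P.d)⁻¹) • ∑ r : Fin P.d → Fin P.L, walkSum Y (walk (emb c.src) (treeWord (boxVec P.L r))) ) )) := by
  refine ⟨fun Y Y' => ?_, fun a Y => ?_⟩
  · exact oneStepDefect_add Y Y' c
  · exact oneStepDefect_smul a Y c

end Linear

end Summit.QuantumFields.YangMills.Theorems.Prop7OneStepDefectSupport

end
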